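import Summits.CriticalPhenomena.CardyFormulaZ2.Theorems.CardyMagicRigidityNestingRigidityNeckZ2CoveringA
import HarnessLib

/-!
# Crux `NestingRigidity`, line `pinch-resampling` (v4), stub S12: bridge structure of a minimal re-connecting family — at most two virtual edges per open cluster

Crux `Summit.CriticalPhenomena.CardyFormulaZ2.Theses.CardyMagicRigidity.NestingRigidity`
(stmt-CriticalPhenomena-4835), line `pinch-resampling` v4, stub S12 `stub_neckHookupCoarseZ2 : NeckHookupCoarseZ2`.
Sequel of `…NeckZ2CoveringA` (worker W1 of wave 5, target `ZNodeAbsBoundA`).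

**Why this file.**  The node event `ZNodeEventA` of `…NeckZ2ErrorCover` keeps, of the minimal re-connecting family
`F` of `NeckCoarseZ2.zCovering_A`, only the four-arm node property over `F`-free shells; that is too permissive for a
union bound built on the tree's arm bounds (`≤ c · ratio^{-exponent}`, non-explicit `c`): families `{z} ∪ C` with `C`
an `M`-non-lacunary spanning background (no `F`-free shell of modulus `≥ M`, hence no certifiable cost) and one
isolated locale `z` carry a single certified annulus of ratio `M`, and the union bound over `z` alone is
`(8s/ℓ) · c M^{-(1+ε)} ↛ 0`.  The minimal family carries more (S11 road map, item 1, "dense clumps"): its edges are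
bridges of the augmented graph with NESTED `b`-sides, so **no open cluster of `Λ_{2s}(x)` contains the locales of
three distinct edges** (`NeckCoarseZ2.not_three_locales_joined`): `j` locales come with `⌈j/2⌉` pairwise
vertex-disjoint open clusters of diameter `≥ lam`, the van den Berg–Kesten input.  §3 re-exports the covering lemma
with this clause (`zCovering_A_clusters`, registered anchor).

* §1 Bridges: an edge `e` is NEEDED if `b, b'` are not chained over `F ∖ {e}`; the step of a full chain leaving the
  `b`-side `S_e = {v | b ⟶ v over F ∖ {e}}` is an `e`-step (`step_eq_of_exit`); real open paths of `Λ_{2s}(x)` do not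
  cross `∂S_e` (`zAugChain_iff_of_pathIn`); a needed edge is not the reverse of another one (`ne_swap_of_needed`).
* §2 Nested sides (`side_subset_or_subset`) and the three-edge exclusion (`not_three_locales_joined`).
* §3 The covering lemma with the cluster clause (`zCovering_A_clusters`).
-/

noncomputable section

namespace Summit.CriticalPhenomena.CardyFormulaZ2.Cruxes.NestingRigidity.PinchResampling

open MeasureTheory Set Literature.Probability.Percolation Literature.Probability.LatticeModels
open ZPinchLocality

namespace NeckCoarseZ2

variable {ℓ lam s : ℕ} {x o : Site 2} {ω : BondConfig (Site 2)}

/-! ## §1 Bridges of the augmented graph -/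

/-- **Exit steps are `e`-steps**: a step of the augmentation by `F` from a point chained to `b` over `F ∖ {e}` to a
point not so chained is the virtual edge `e`, in one of its two orientations. -/
theorem step_eq_of_exit {F : Set (Site 2 × Site 2)} {e : Site 2 × Site 2} {b y z : Site 2}
    (hyz : (y, z) ∈ zAugSteps s x ω F)
    (hy : Relation.ReflTransGen (fun a c ↦ (a, c) ∈ zAugSteps s x ω (F \ {e})) b y)
    (hz : ¬ Relation.ReflTransGen (fun a c ↦ (a, c) ∈ zAugSteps s x ω (F \ {e})) b z) :
    (y, z) = e ∨ (z, y) = e := by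
  rcases hyz with hreal | hF | hF
  · exact (hz (hy.tail (Or.inl hreal))).elim
  · by_cases h : (y, z) = e
    · exact Or.inl h
    · exact (hz (hy.tail (Or.inr (Or.inl ⟨hF, h⟩)))).elim
  · by_cases h : (z, y) = e
    · exact Or.inr h
    · exact (hz (hy.tail (Or.inr (Or.inr ⟨hF, h⟩)))).elim

/-- **Real classes**: two points joined by an open path of `Λ_{2s}(x)` are chained to `b` over `G` simultaneously. -/
theorem zAugChain_iff_of_pathIn (G : Set (Site 2 × Site 2)) {b u v : Site 2}
    (h : PathIn (openGraph ω) (zBall x (2 * s)) u v) :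
    Relation.ReflTransGen (fun a c ↦ (a, c) ∈ zAugSteps s x ω G) b u ↔
      Relation.ReflTransGen (fun a c ↦ (a, c) ∈ zAugSteps s x ω G) b v :=
  ⟨fun hu ↦ hu.trans (zAugChain_of_pathIn G Subset.rfl h),
    fun hv ↦ hv.trans (zAugChain_of_pathIn G Subset.rfl h.symm)⟩

/-- A needed edge belongs to the family. -/
theorem mem_of_needed {F : Set (Site 2 × Site 2)} {e : Site 2 × Site 2} {b b' : Site 2}
    (hconn : Relation.ReflTransGen (fun a c ↦ (a, c) ∈ zAugSteps s x ω F) b b')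
    (he : ¬ Relation.ReflTransGen (fun a c ↦ (a, c) ∈ zAugSteps s x ω (F \ {e})) b b') : e ∈ F := by
  by_contra h
  rw [sdiff_singleton_eq_self h] at he
  exact he hconn

/-- **A needed edge is not the reverse of another needed edge** (the reverse would serve in its place). -/
theorem ne_swap_of_needed {F : Set (Site 2 × Site 2)} {e e' : Site 2 × Site 2} {b b' : Site 2}
    (hconn : Relation.ReflTransGen (fun a c ↦ (a, c) ∈ zAugSteps s x ω F) b b')
    (he : ¬ Relation.ReflTransGen (fun a c ↦ (a, c) ∈ zAugSteps s x ω (F \ {e})) b b')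
    (he' : ¬ Relation.ReflTransGen (fun a c ↦ (a, c) ∈ zAugSteps s x ω (F \ {e'})) b b') (hne : e ≠ e') :
    e' ≠ (e.2, e.1) := by
  intro hsw
  have heF : e ∈ F := mem_of_needed hconn he
  have heF' : e ∈ F \ {e'} := ⟨heF, hne⟩
  refine he' (Relation.ReflTransGen.mono (p := fun a c ↦ (a, c) ∈ zAugSteps s x ω (F \ {e'}))
    (fun u v (huv : (u, v) ∈ zAugSteps s x ω F) ↦ ?_) b b' hconn)
  rcases huv with hreal | hF | hF
  · exact Or.inl hreal
  · by_cases h : (u, v) = e'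
    · refine Or.inr (Or.inr ?_)
      have huv : u = e.2 ∧ v = e.1 := by simpa only [Prod.mk.injEq] using h.trans hsw
      obtain ⟨rfl, rfl⟩ := huv
      exact heF'
    · exact Or.inr (Or.inl ⟨hF, h⟩)
  · by_cases h : (v, u) = e'
    · refine Or.inr (Or.inl ?_)
      have huv : v = e.2 ∧ u = e.1 := by simpa only [Prod.mk.injEq] using h.trans hsw
      obtain ⟨rfl, rfl⟩ := huv
      exact heF'
    · exact Or.inr (Or.inr ⟨hF, h⟩)

/-- An `f`-step of the full augmentation is a step of the augmentation by `F ∖ {f'}`, for needed `f ≠ f'`. -/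
theorem step_mem_diff_of_needed {F : Set (Site 2 × Site 2)} {f f' : Site 2 × Site 2} {b b' y z : Site 2}
    (hconn : Relation.ReflTransGen (fun a c ↦ (a, c) ∈ zAugSteps s x ω F) b b')
    (hf : ¬ Relation.ReflTransGen (fun a c ↦ (a, c) ∈ zAugSteps s x ω (F \ {f})) b b')
    (hf' : ¬ Relation.ReflTransGen (fun a c ↦ (a, c) ∈ zAugSteps s x ω (F \ {f'})) b b') (hne : f ≠ f')
    (hyz : (y, z) ∈ zAugSteps s x ω F) (hor : (y, z) = f ∨ (z, y) = f) :
    (y, z) ∈ zAugSteps s x ω (F \ {f'}) := by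
  have hsw : f' ≠ (f.2, f.1) := ne_swap_of_needed hconn hf hf' hne
  rcases hyz with hreal | hF | hF
  · exact Or.inl hreal
  · refine Or.inr (Or.inl ⟨hF, fun h ↦ ?_⟩)
    rcases hor with h' | h'
    · exact hne (h'.symm.trans h)
    · exact hsw (by rw [← h, ← h'])
  · refine Or.inr (Or.inr ⟨hF, fun h ↦ ?_⟩)
    rcases hor with h' | h'
    · exact hsw (by rw [← h, ← h'])
    · exact hne (h'.symm.trans h)

/-! ## §2 Nested sides and the three-edge exclusion -/

/-- **Both endpoints of a needed edge `e'` lie in the union of the `b`-sides of `e` and `e'`**, as soon as some point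
is chained to `b` over `F ∖ {e}` but not over `F ∖ {e'}`. -/
theorem endpoints_mem_union {F : Set (Site 2 × Site 2)} {e e' : Site 2 × Site 2} {b v : Site 2}
    (hv : Relation.ReflTransGen (fun a c ↦ (a, c) ∈ zAugSteps s x ω (F \ {e})) b v)
    (hv' : ¬ Relation.ReflTransGen (fun a c ↦ (a, c) ∈ zAugSteps s x ω (F \ {e'})) b v) :
    ∀ p, (p = e'.1 ∨ p = e'.2) →
      Relation.ReflTransGen (fun a c ↦ (a, c) ∈ zAugSteps s x ω (F \ {e})) b p ∨
        Relation.ReflTransGen (fun a c ↦ (a, c) ∈ zAugSteps s x ω (F \ {e'})) b p := by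
  -- exit from the set of points chained over `F ∖ {e} ∖ {e'}` along the chain `b ⟶ v` over `F ∖ {e}`
  have hsub : (F \ {e}) \ {e'} ⊆ F \ {e'} := fun q hq ↦ ⟨hq.1.1, hq.2⟩
  have hvS : ¬ Relation.ReflTransGen (fun a c ↦ (a, c) ∈ zAugSteps s x ω ((F \ {e}) \ {e'})) b v :=
    fun h ↦ hv' (zAugChain_mono hsub h)
  obtain ⟨y, z, hy, hz, hyz, hby⟩ := zAugChain_exists_step_out
    (P := {u | Relation.ReflTransGen (fun a c ↦ (a, c) ∈ zAugSteps s x ω ((F \ {e}) \ {e'})) b u}) hv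
    Relation.ReflTransGen.refl hvS
  simp only [mem_setOf_eq] at hy hz
  have hor : (y, z) = e' ∨ (z, y) = e' := step_eq_of_exit hyz hy hz
  have hbz : Relation.ReflTransGen (fun a c ↦ (a, c) ∈ zAugSteps s x ω (F \ {e})) b z := hby.tail hyz
  have hby' : Relation.ReflTransGen (fun a c ↦ (a, c) ∈ zAugSteps s x ω (F \ {e'})) b y :=
    zAugChain_mono hsub hy
  intro p hp
  rcases hor with h | h
  · -- `e' = (y, z)`
    rw [← h] at hp
    rcases hp with rfl | rfl
    · exact Or.inr hby'
    · exact Or.inl hbz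
  · -- `e' = (z, y)`
    rw [← h] at hp
    rcases hp with rfl | rfl
    · exact Or.inl hbz
    · exact Or.inr hby'

/-- **Nestedness of the `b`-sides of two needed edges.** -/
theorem side_subset_or_subset {F : Set (Site 2 × Site 2)} {e e' : Site 2 × Site 2} {b b' : Site 2}
    (hconn : Relation.ReflTransGen (fun a c ↦ (a, c) ∈ zAugSteps s x ω F) b b')
    (he : ¬ Relation.ReflTransGen (fun a c ↦ (a, c) ∈ zAugSteps s x ω (F \ {e})) b b')
    (he' : ¬ Relation.ReflTransGen (fun a c ↦ (a, c) ∈ zAugSteps s x ω (F \ {e'})) b b') :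
    {v | Relation.ReflTransGen (fun a c ↦ (a, c) ∈ zAugSteps s x ω (F \ {e})) b v} ⊆
        {v | Relation.ReflTransGen (fun a c ↦ (a, c) ∈ zAugSteps s x ω (F \ {e'})) b v} ∨
      {v | Relation.ReflTransGen (fun a c ↦ (a, c) ∈ zAugSteps s x ω (F \ {e'})) b v} ⊆
        {v | Relation.ReflTransGen (fun a c ↦ (a, c) ∈ zAugSteps s x ω (F \ {e})) b v} := by
  by_contra hcon
  rw [not_or] at hcon
  obtain ⟨⟨v, hv, hv'⟩, ⟨u, hu, hu'⟩⟩ := And.intro (not_subset.1 hcon.1) (not_subset.1 hcon.2)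
  simp only [mem_setOf_eq] at hv hv' hu hu'
  -- both endpoints of `e'` and of `e` lie in the union `T` of the two sides
  let T : Set (Site 2) := {p | Relation.ReflTransGen (fun a c ↦ (a, c) ∈ zAugSteps s x ω (F \ {e})) b p ∨
    Relation.ReflTransGen (fun a c ↦ (a, c) ∈ zAugSteps s x ω (F \ {e'})) b p}
  have hT' : ∀ p, (p = e'.1 ∨ p = e'.2) → p ∈ T := endpoints_mem_union hv hv'
  have hT : ∀ p, (p = e.1 ∨ p = e.2) → p ∈ T := fun p hp ↦ (endpoints_mem_union hu hu' p hp).symm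
  -- exit from `T` along the full chain
  have hbT : b ∈ T := Or.inl Relation.ReflTransGen.refl
  have hb'T : b' ∉ T := fun h ↦ h.elim he he'
  obtain ⟨y, z, hy, hz, hyz, -⟩ := zAugChain_exists_step_out (P := T) hconn hbT hb'T
  rcases hy with hy | hy
  · rcases step_eq_of_exit hyz hy (fun h ↦ hz (Or.inl h)) with h | h
    · exact hz (hT z (Or.inr (by rw [← h])))
    · exact hz (hT z (Or.inl (by rw [← h])))
  · rcases step_eq_of_exit hyz hy (fun h ↦ hz (Or.inr h)) with h | h
    · exact hz (hT' z (Or.inr (by rw [← h])))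
    · exact hz (hT' z (Or.inl (by rw [← h])))

/-- **The three-edge exclusion, sorted form**: for needed edges `f₁ ≠ f₂`, `f₃ ≠ f₂` with sides
`S_{f₁} ⊆ S_{f₂} ⊆ S_{f₃}`, the locales of `f₁` and `f₃` are not joined by an open path of `Λ_{2s}(x)`. -/
theorem not_joined_of_sides_sorted {F : Set (Site 2 × Site 2)} {f₁ f₂ f₃ : Site 2 × Site 2} {b b' : Site 2}
    (hconn : Relation.ReflTransGen (fun a c ↦ (a, c) ∈ zAugSteps s x ω F) b b')
    (hf₁ : ¬ Relation.ReflTransGen (fun a c ↦ (a, c) ∈ zAugSteps s x ω (F \ {f₁})) b b')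
    (hf₂ : ¬ Relation.ReflTransGen (fun a c ↦ (a, c) ∈ zAugSteps s x ω (F \ {f₂})) b b')
    (hf₃ : ¬ Relation.ReflTransGen (fun a c ↦ (a, c) ∈ zAugSteps s x ω (F \ {f₃})) b b')
    (h₁₂ : f₁ ≠ f₂) (h₃₂ : f₃ ≠ f₂)
    (hS₁₂ : {v | Relation.ReflTransGen (fun a c ↦ (a, c) ∈ zAugSteps s x ω (F \ {f₁})) b v} ⊆
      {v | Relation.ReflTransGen (fun a c ↦ (a, c) ∈ zAugSteps s x ω (F \ {f₂})) b v})
    (hS₂₃ : {v | Relation.ReflTransGen (fun a c ↦ (a, c) ∈ zAugSteps s x ω (F \ {f₂})) b v} ⊆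
      {v | Relation.ReflTransGen (fun a c ↦ (a, c) ∈ zAugSteps s x ω (F \ {f₃})) b v}) :
    ¬ PathIn (openGraph ω) (zBall x (2 * s)) f₁.2 f₃.2 := by
  intro hp
  -- both endpoints of `f₁` are in `S_{f₂}`
  obtain ⟨y, z, hy, hz, hyz, -⟩ := zAugChain_exists_step_out
    (P := {v | Relation.ReflTransGen (fun a c ↦ (a, c) ∈ zAugSteps s x ω (F \ {f₁})) b v}) hconn
    Relation.ReflTransGen.refl hf₁
  simp only [mem_setOf_eq] at hy hz
  have hor := step_eq_of_exit hyz hy hz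
  have hy₂ : Relation.ReflTransGen (fun a c ↦ (a, c) ∈ zAugSteps s x ω (F \ {f₂})) b y := hS₁₂ hy
  have hz₂ : Relation.ReflTransGen (fun a c ↦ (a, c) ∈ zAugSteps s x ω (F \ {f₂})) b z :=
    hy₂.tail (step_mem_diff_of_needed hconn hf₁ hf₂ h₁₂ hyz hor)
  have h₁ : Relation.ReflTransGen (fun a c ↦ (a, c) ∈ zAugSteps s x ω (F \ {f₂})) b f₁.2 := by
    rcases hor with h | h
    · rw [← h]; exact hz₂
    · rw [← h]; exact hy₂
  -- both endpoints of `f₃` are outside `S_{f₂}`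
  obtain ⟨y', z', hy', hz', hyz', -⟩ := zAugChain_exists_step_out
    (P := {v | Relation.ReflTransGen (fun a c ↦ (a, c) ∈ zAugSteps s x ω (F \ {f₃})) b v}) hconn
    Relation.ReflTransGen.refl hf₃
  simp only [mem_setOf_eq] at hy' hz'
  have hor' := step_eq_of_exit hyz' hy' hz'
  have hz'₂ : ¬ Relation.ReflTransGen (fun a c ↦ (a, c) ∈ zAugSteps s x ω (F \ {f₂})) b z' :=
    fun h ↦ hz' (hS₂₃ h)
  have hy'₂ : ¬ Relation.ReflTransGen (fun a c ↦ (a, c) ∈ zAugSteps s x ω (F \ {f₂})) b y' :=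
    fun h ↦ hz'₂ (h.tail (step_mem_diff_of_needed hconn hf₃ hf₂ h₃₂ hyz' hor'))
  have h₃ : ¬ Relation.ReflTransGen (fun a c ↦ (a, c) ∈ zAugSteps s x ω (F \ {f₂})) b f₃.2 := by
    rcases hor' with h | h
    · rw [← h]; exact hz'₂
    · rw [← h]; exact hy'₂
  exact h₃ ((zAugChain_iff_of_pathIn (F \ {f₂}) hp).1 h₁)

/-- **No open cluster of `Λ_{2s}(x)` contains the locales of three distinct needed virtual edges.**  (So the map
"edge ↦ open cluster of its locale" is at most two-to-one on a minimal re-connecting family: the BK structure of the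
`𝔄`-error.) -/
theorem not_three_locales_joined {F : Set (Site 2 × Site 2)} {e₁ e₂ e₃ : Site 2 × Site 2} {b b' : Site 2}
    (hconn : Relation.ReflTransGen (fun a c ↦ (a, c) ∈ zAugSteps s x ω F) b b')
    (he₁ : ¬ Relation.ReflTransGen (fun a c ↦ (a, c) ∈ zAugSteps s x ω (F \ {e₁})) b b')
    (he₂ : ¬ Relation.ReflTransGen (fun a c ↦ (a, c) ∈ zAugSteps s x ω (F \ {e₂})) b b')
    (he₃ : ¬ Relation.ReflTransGen (fun a c ↦ (a, c) ∈ zAugSteps s x ω (F \ {e₃})) b b')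
    (h₁₂ : e₁ ≠ e₂) (h₂₃ : e₂ ≠ e₃) (h₁₃ : e₁ ≠ e₃)
    (hp₁₂ : PathIn (openGraph ω) (zBall x (2 * s)) e₁.2 e₂.2)
    (hp₂₃ : PathIn (openGraph ω) (zBall x (2 * s)) e₂.2 e₃.2) : False := by
  have hp₁₃ := hp₁₂.trans hp₂₃
  have n₁₂ := side_subset_or_subset hconn he₁ he₂
  have n₂₃ := side_subset_or_subset hconn he₂ he₃
  have n₁₃ := side_subset_or_subset hconn he₁ he₃
  -- sort the three sides and apply the sorted form to the outer pair
  rcases n₁₂ with h12 | h21 <;> rcases n₂₃ with h23 | h32 <;> rcases n₁₃ with h13 | h31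
  · exact not_joined_of_sides_sorted hconn he₁ he₂ he₃ h₁₂ h₂₃.symm h12 h23 hp₁₃
  · exact not_joined_of_sides_sorted hconn he₁ he₂ he₃ h₁₂ h₂₃.symm h12 h23 hp₁₃
  · exact not_joined_of_sides_sorted hconn he₁ he₃ he₂ h₁₃ h₂₃ h13 h32 hp₁₂
  · exact not_joined_of_sides_sorted hconn he₃ he₁ he₂ h₁₃.symm h₁₂.symm h31 h12 hp₂₃.symm
  · exact not_joined_of_sides_sorted hconn he₂ he₁ he₃ h₁₂.symm h₁₃.symm h21 h13 hp₂₃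
  · exact not_joined_of_sides_sorted hconn he₂ he₃ he₁ h₂₃ h₁₃ h23 h31 hp₁₂.symm
  · exact not_joined_of_sides_sorted hconn he₃ he₂ he₁ h₂₃.symm h₁₂ h32 h21 hp₁₃.symm
  · exact not_joined_of_sides_sorted hconn he₃ he₂ he₁ h₂₃.symm h₁₂ h32 h21 hp₁₃.symm

/-! ## §3 The covering lemma with the cluster clause -/

/-- **A minimal re-connecting family**: under the hypotheses of `zCovering_A` there is a nonempty finite family of
virtual edges over which `b, b'` are chained and every edge of which is needed. -/
theorem exists_needed_family {b b' : Site 2} (hnR : ¬ PathIn (openGraph ω) (zBall x (2 * s)) b b')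
    (hbO : b ∈ zBall x (2 * s))
    (hchain : Relation.ReflTransGen (fun a c ↦ (a, c) ∈ zAugSteps s x ω (zVEdges ℓ lam s x o ω)) b b') :
    ∃ F : Finset (Site 2 × Site 2), ↑F ⊆ zVEdges ℓ lam s x o ω ∧ F.Nonempty ∧
      Relation.ReflTransGen (fun a c ↦ (a, c) ∈ zAugSteps s x ω ↑F) b b' ∧
      ∀ e ∈ F, ¬ Relation.ReflTransGen (fun a c ↦ (a, c) ∈ zAugSteps s x ω (↑F \ {e})) b b' := by
  classical
  -- adapted from `NeckCoarseZ2.zCovering_A` (`…NeckZ2CoveringA`): the same cardinality-minimal family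
  set U : Finset (Site 2 × Site 2) := (zVEdges_finite ℓ lam s x o ω).toFinset with hU
  let chain : Finset (Site 2 × Site 2) → Prop := fun F ↦
    Relation.ReflTransGen (fun a c ↦ (a, c) ∈ zAugSteps s x ω ↑F) b b'
  set 𝒞 := U.powerset.filter chain with h𝒞
  have hU𝒞 : U ∈ 𝒞 := by
    refine Finset.mem_filter.2 ⟨Finset.mem_powerset.2 subset_rfl, ?_⟩
    simpa [chain, hU] using hchain
  obtain ⟨F, hF𝒞, hFmin⟩ := Finset.exists_min_image 𝒞 Finset.card ⟨U, hU𝒞⟩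
  obtain ⟨hFU, hFchain⟩ := Finset.mem_filter.1 hF𝒞
  have hFU' : (↑F : Set (Site 2 × Site 2)) ⊆ zVEdges ℓ lam s x o ω := fun e he ↦ by
    have := Finset.mem_powerset.1 hFU he
    simpa [hU] using this
  refine ⟨F, hFU', ?_, hFchain, fun e he hch ↦ ?_⟩
  · -- `F` is nonempty: with no virtual edge the chain would be a real path
    by_contra hemp
    rw [Finset.not_nonempty_iff_eq_empty] at hemp
    rcases real_or_endpoint_of_zAugChain (G := (↑F : Set (Site 2 × Site 2)))
      (fun e he ↦ mem_zBall_of_mem_zVEdges (hFU' he)) hbO hFchain with h | ⟨e, he, -⟩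
    · exact hnR h
    · simp [hemp] at he
  · -- every edge is needed: `F.erase e` would be a smaller member of `𝒞`
    have hmem : F.erase e ∈ 𝒞 := by
      refine Finset.mem_filter.2 ⟨Finset.mem_powerset.2 ((Finset.erase_subset e F).trans
        (Finset.mem_powerset.1 hFU)), ?_⟩
      simpa [chain, Finset.coe_erase] using hch
    have h1 := hFmin _ hmem
    have h2 : (F.erase e).card < F.card := Finset.card_erase_lt_of_mem he
    omega

/-- **Node property of a needed family** (the four-arm clause of `zCovering_A`, for any family over which `b, b'`
are chained and every edge of which is needed). -/
theorem nodes_of_needed (hHG : ∀ a b, (openGraph ω).Adj a b → (zdGraph 2).Adj a b) (hℓ : 1 ≤ ℓ) {b b' : Site 2}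
    (hb : IsCrossing (zdGraph 2) (openGraph ω) (zBall x s) (zBall x (2 * s)) b)
    (hb' : IsCrossing (zdGraph 2) (openGraph ω) (zBall x s) (zBall x (2 * s)) b')
    {F : Finset (Site 2 × Site 2)} (hFU' : ↑F ⊆ zVEdges ℓ lam s x o ω)
    (hFchain : Relation.ReflTransGen (fun a c ↦ (a, c) ∈ zAugSteps s x ω ↑F) b b')
    (hneeded : ∀ e ∈ F, ¬ Relation.ReflTransGen (fun a c ↦ (a, c) ∈ zAugSteps s x ω (↑F \ {e})) b b') :
    ∀ 𝒩 ⊆ F, 𝒩.Nonempty → ∀ (w : Site 2) (Δ r R Γ : ℕ),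
      w ∈ innerLayer (zdGraph 2) (zBall x s) (zBall x (2 * s)) →
      (∀ e ∈ 𝒩, zNorm (e.2 - w) ≤ Δ) → (∀ e ∈ F, e ∉ 𝒩 → (Γ : ℤ) ≤ zNorm (e.2 - w)) →
      Δ + ℓ ≤ r → r ≤ R → R + ℓ ≤ Γ → R + 1 ≤ s → ω ∈ fourArmTwoClustersAt w r R := by
  classical
  -- adapted from `NeckCoarseZ2.zCovering_A` (`…NeckZ2CoveringA`), with single-edge minimality
  set O := zBall x (2 * s) with hO
  set H := openGraph ω with hH
  have hmin : ∀ 𝒩 ⊆ F, 𝒩.Nonempty →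
      ¬ Relation.ReflTransGen (fun a c ↦ (a, c) ∈ zAugSteps s x ω ↑(F \ 𝒩)) b b' := by
    intro 𝒩 h𝒩 hne hch
    obtain ⟨e, he⟩ := hne
    refine hneeded e (h𝒩 he) (zAugChain_mono (fun q hq ↦ ?_) hch)
    have hq' : q ∈ F ∧ q ∉ 𝒩 := by simpa using hq
    exact ⟨hq'.1, fun h ↦ hq'.2 (by rw [mem_singleton_iff.1 h]; exact he)⟩
  intro 𝒩 h𝒩 hne w Δ r R Γ hw hΔ hΓ hr hrR hRΓ hRs
  set G : Set (Site 2 × Site 2) := ↑(F \ 𝒩) with hG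
  have hGF : G ⊆ ↑F := by intro e he; exact (Finset.mem_sdiff.1 (Finset.mem_coe.1 he)).1
  have hGO : ∀ e ∈ G, e.1 ∈ O ∧ e.2 ∈ O := fun e he ↦ mem_zBall_of_mem_zVEdges (hFU' (hGF he))
  have hnG : ¬ Relation.ReflTransGen (fun a c ↦ (a, c) ∈ zAugSteps s x ω G) b b' := hmin 𝒩 h𝒩 hne
  have hout : ∀ {c₀ c₁ : Site 2}, Relation.ReflTransGen (fun a c ↦ (a, c) ∈ zAugSteps s x ω ↑F) c₀ c₁ →
      ¬ Relation.ReflTransGen (fun a c ↦ (a, c) ∈ zAugSteps s x ω G) c₀ c₁ →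
      ∃ y e, e ∈ 𝒩 ∧ (y = e.1 ∨ y = e.2) ∧ Relation.ReflTransGen (fun a c ↦ (a, c) ∈ zAugSteps s x ω G) c₀ y := by
    intro c₀ c₁ hch hn
    obtain ⟨y, z, hy, hz, hyz, -⟩ := zAugChain_exists_step_out
      (P := {t | Relation.ReflTransGen (fun a c ↦ (a, c) ∈ zAugSteps s x ω G) c₀ t}) hch Relation.ReflTransGen.refl hn
    simp only [mem_setOf_eq] at hy hz
    rcases hyz with hreal | hF | hF
    · exact (hz (hy.tail (Or.inl hreal))).elim
    · by_cases hN : (y, z) ∈ 𝒩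
      · exact ⟨y, (y, z), hN, Or.inl rfl, hy⟩
      · exact (hz (hy.tail (Or.inr (Or.inl (Finset.mem_coe.2 (Finset.mem_sdiff.2 ⟨Finset.mem_coe.1 hF, hN⟩)))))).elim
    · by_cases hN : (z, y) ∈ 𝒩
      · exact ⟨y, (z, y), hN, Or.inr rfl, hy⟩
      · exact (hz (hy.tail (Or.inr (Or.inr (Finset.mem_coe.2 (Finset.mem_sdiff.2 ⟨Finset.mem_coe.1 hF, hN⟩)))))).elim
  obtain ⟨y, e₁, he₁, hy₁, hby⟩ := hout hFchain hnG
  obtain ⟨y', e₂, he₂, hy₂, hb'y'⟩ := hout (zAugChain_symm hFchain) fun h ↦ hnG (zAugChain_symm h)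
  have hnyy' : ¬ PathIn H O y y' := fun hp ↦
    hnG ((hby.trans (zAugChain_of_pathIn G Subset.rfl hp)).trans (zAugChain_symm hb'y'))
  -- near: endpoints of `𝒩`-edges are inside `Λ_{r-1}(w)`
  have hnear : ∀ {y : Site 2} {e : Site 2 × Site 2}, e ∈ 𝒩 → (y = e.1 ∨ y = e.2) → zNorm (y - w) < r := by
    intro y e he hy
    have hΔe := hΔ e he
    have hev : e ∈ zVEdges ℓ lam s x o ω := hFU' (h𝒩 he)
    rcases hy with rfl | rfl
    · have h1 := zNorm_sub_lt_of_mem_zVEdges hℓ (show (e.1, e.2) ∈ zVEdges ℓ lam s x o ω from hev)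
      have h2 := zNorm_sub_le_add e.1 e.2 w
      omega
    · omega
  -- far: each class reaches sup distance `≥ R` from `w`
  have hfar : ∀ {c₀ y : Site 2}, IsCrossing (zdGraph 2) H (zBall x s) O c₀ →
      Relation.ReflTransGen (fun a c ↦ (a, c) ∈ zAugSteps s x ω G) c₀ y →
      ∃ q, PathIn H O y q ∧ (R : ℤ) ≤ zNorm (q - w) := by
    intro c₀ y hc₀ hch
    rcases real_or_endpoint_of_zAugChain hGO hc₀.1.1.1 hch with hp | ⟨e, he, hp | hp⟩
    · obtain ⟨-, q, hqo, hpq⟩ := hc₀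
      refine ⟨q, (PathIn.symm hp).trans (hpq.mono Set.sdiff_subset), ?_⟩
      have h1 := zNorm_eq_of_mem_outerLayer hqo
      have h2 := zNorm_eq_of_mem_innerLayer hw
      have h3 := zNorm_sub_le_add q w x
      omega
    · have heF : e ∈ F ∧ e ∉ 𝒩 := by simpa [hG] using he
      have hΓe := hΓ e heF.1 heF.2
      have hev : e ∈ zVEdges ℓ lam s x o ω := hFU' heF.1
      refine ⟨e.1, PathIn.symm hp, ?_⟩
      have h1 := zNorm_sub_lt_of_mem_zVEdges hℓ (show (e.1, e.2) ∈ zVEdges ℓ lam s x o ω from hev)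
      have h2 := zNorm_sub_le_add e.2 e.1 w
      have h3 : zNorm (e.2 - e.1) = zNorm (e.1 - e.2) := zNorm_sub_comm _ _
      omega
    · have heF : e ∈ F ∧ e ∉ 𝒩 := by simpa [hG] using he
      have hΓe := hΓ e heF.1 heF.2
      exact ⟨e.2, PathIn.symm hp, by omega⟩
  obtain ⟨q, hyq, hqR⟩ := hfar hb hby
  obtain ⟨q', hy'q', hq'R⟩ := hfar hb' hb'y'
  obtain ⟨p₁, q₁, hp₁, hq₁, hcross₁, hyp₁⟩ := exists_zAnn_crossing_of_pathIn hHG hrR (hnear he₁ hy₁) hqR hyq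
  obtain ⟨p₂, q₂, hp₂, hq₂, hcross₂, hy'p₂⟩ := exists_zAnn_crossing_of_pathIn hHG hrR (hnear he₂ hy₂) hq'R hy'q'
  refine mem_fourArmTwoClustersAt_of_crossings (by omega) hrR hp₁ hq₁ hp₂ hq₂ (hcross₁.mono inter_subset_right)
    (hcross₂.mono inter_subset_right) fun h12 ↦ hnyy' ?_
  exact hyp₁.trans ((h12.mono (zAnn_subset_zBall hw hRs)).trans (PathIn.symm hy'p₂))

end NeckCoarseZ2

/-- **Covering lemma for `𝔄` on `ℤ²`, node form with the cluster clause (registered helper, anchor of this module on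
the crux item)**: as `zCovering_A_nodes` (`…NeckZ2CoveringA`), and moreover no open cluster of `Λ_{2s}(x)` contains the
locales of three distinct edges of the family (the map "virtual edge ↦ open cluster of its locale" is at most
two-to-one: `j` locales come with `⌈j/2⌉` pairwise vertex-disjoint open clusters of sup-diameter `≥ lam`). -/
theorem zCovering_A_clusters : ∀ (ℓ lam s : ℕ) (x o : Site 2) (ω : BondConfig (Site 2)), (∀ a b, (openGraph ω).Adj a b → (zdGraph 2).Adj a b) → 1 ≤ ℓ → ∀ b b' : Site 2, IsCrossing (zdGraph 2) (openGraph ω) (zBall x s) (zBall x (2 * s)) b → IsCrossing (zdGraph 2) (openGraph ω) (zBall x s) (zBall x (2 * s)) b' → ¬ PathIn (openGraph ω) (zBall x (2 * s)) b b' → Relation.ReflTransGen (fun a c ↦ (a, c) ∈ NeckCoarseZ2.zAugSteps s x ω (NeckCoarseZ2.zVEdges ℓ lam s x o ω)) b b' → ∃ F : Finset (Site 2 × Site 2), ↑F ⊆ NeckCoarseZ2.zVEdges ℓ lam s x o ω ∧ F.Nonempty ∧ (∀ 𝒩 ⊆ F, 𝒩.Nonempty → ∀ (w : Site 2) (Δ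 r R Γ : ℕ), w ∈ innerLayer (zdGraph 2) (zBall x s) (zBall x (2 * s)) → (∀ e ∈ 𝒩, zNorm (e.2 - w) ≤ Δ) → (∀ e ∈ F, e ∉ 𝒩 → (Γ : ℤ) ≤ zNorm (e.2 - w)) → Δ + ℓ ≤ r → r ≤ R → R + ℓ ≤ Γ → R + 1 ≤ s → ω ∈ fourArmTwoClustersAt w r R) ∧ ∀ e₁ ∈ F, ∀ e₂ ∈ F, ∀ e₃ ∈ F, e₁ ≠ e₂ → e₂ ≠ e₃ → e₁ ≠ e₃ → ¬ (PathIn (openGraph ω) (zBall x (2 * s)) e₁.2 e₂.2 ∧ PathIn (openGraph ω) (zBall x (2 * s)) e₂.2 e₃.2) := by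
  intro ℓ lam s x o ω hHG hℓ b b' hb hb' hnR hchain
  obtain ⟨F, hFU', hne, hFchain, hneeded⟩ := NeckCoarseZ2.exists_needed_family hnR hb.1.1.1 hchain
  refine ⟨F, hFU', hne, NeckCoarseZ2.nodes_of_needed hHG hℓ hb hb' hFU' hFchain hneeded, ?_⟩
  intro e₁ he₁ e₂ he₂ e₃ he₃ h₁₂ h₂₃ h₁₃ ⟨hp₁₂, hp₂₃⟩
  exact NeckCoarseZ2.not_three_locales_joined hFchain (hneeded e₁ he₁) (hneeded e₂ he₂) (hneeded e₃ he₃) h₁₂ h₂₃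
    h₁₃ hp₁₂ hp₂₃

end Summit.CriticalPhenomena.CardyFormulaZ2.Cruxes.NestingRigidity.PinchResampling

end
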